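import Mathlib
import HarnessLib
import Summits.NavierStokesRegularity.NavierStokesRegularity.Theorems.ChiralWindowDoorDefs
import Summits.NavierStokesRegularity.NavierStokesRegularity.Theorems.ChiralWindowDoorLocalHelicityLower
import Summits.NavierStokesRegularity.NavierStokesRegularity.Theorems.ChiralWindowDoorTimeIntegratedError
import Summits.NavierStokesRegularity.NavierStokesRegularity.Theorems.ChiralWindowDoorLocalDissipationPointwise
import Summits.NavierStokesRegularity.NavierStokesRegularity.Theorems.ChiralWindowDoorLocalDissipationLower
import Summits.NavierStokesRegularity.NavierStokesRegularity.Theorems.ChiralWindowDoorClassDerivDecay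

/-!
# Door S20 «ChiralWindowDoor» — tools for stub B3 `stub_helicityBudget`: size of the localised helicity and of the
# localised helicity dissipation of a door-class profile in time

Door S20 of nsreg-p1's local Type-I door family (`HOME/ns-regularity-ideate-p1/r19/R19-LINE.md` §B3; DESIGN-ONLY,
route NOT born).  B3 integrates the localised helicity identity `d/dt h_R = −2 d̃_R + F_R` over `(−∞, t₀]`; besides the
identity and the flux bounds it needs (i) `h_R(t) → 0` as `t → −∞` and (ii) the integrability of
`t ↦ d̃_R(t) = locHelicity a_R (curl v(t))` on `(−∞, t₀)`, `t₀ < 0`.  Both follow from the all-orders scale-invariant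
package of the class (`…ClassDerivDecay.exists_classical_scaleInvariantBounds_of_class`) and the compact support of
`a_R`; (ii) also uses the `t`-measurability proved in `…LocalDissipationLower`:

* `abs_locHelicity_slice_le` — `|h_R(t)| ≤ |B_{2R}| · (C/√(−t)) · (‖curlCLM‖|L₁|/(−t))`;
* `tendsto_locHelicity_atBot` — **`h_R(t) → 0` as `t → −∞`**;
* `abs_locHelicity_curl_slice_le` — `|d̃_R(t)| ≤ |B_{2R}| · ‖curlCLM‖²|L₁||L₂| · (−t)^{−5/2}`;
* `integrableOn_locHelicity_curl` — **`t ↦ d̃_R(t)` is integrable on `(−∞, t₀)` for `t₀ < 0`.**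

Seat nsreg-p6 g11 (THEOREMS-ONLY door sequels, DIRECTOR-NS g8 #32 (2)/#36).  WHAT THIS IS NOT: not NS regularity
(Clay A); not B3 (the identity and the flux bounds remain); no route is opened.
-/

noncomputable section

-- the summit and its single sub-problem share the name (CONVENTIONS §1), as in every Theorems file
set_option linter.dupNamespace false

namespace Summit.NavierStokesRegularity.NavierStokesRegularity.Theorems.ChiralWindowDoorHelicityBudgetTools

open MeasureTheory Set Filter Topology Metric Function
open scoped RealInnerProductSpace
open Literature.Analysis Literature.Analysis.FluidPDE
open Summit.NavierStokesRegularity.NavierStokesRegularity.Theorems.ChiralWindowDoorDefs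
open Summit.NavierStokesRegularity.NavierStokesRegularity.Theorems.ChiralWindowDoorLocalHelicityLower
open Summit.NavierStokesRegularity.NavierStokesRegularity.Theorems.ChiralWindowDoorTimeIntegratedError
open Summit.NavierStokesRegularity.NavierStokesRegularity.Theorems.ChiralWindowDoorLocalDissipationPointwise
  (vorticity_slice_regularity)
open Summit.NavierStokesRegularity.NavierStokesRegularity.Theorems.ChiralWindowDoorLocalDissipationLower
open Summit.NavierStokesRegularity.NavierStokesRegularity.Theorems.ChiralWindowDoorClassDerivDecay
  (exists_classical_scaleInvariantBounds_of_class)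
open Summit.NavierStokesRegularity.NavierStokesRegularity.Theorems.PoloidalWindowDoorPoloidalWindowRigidityWindow
  (isTypeIAncientMild_of_class)
open Summit.NavierStokesRegularity.NavierStokesRegularity.Theorems.LocalSineTubeDoorProfileAlignedWindowRigidityAncient
  (analyticOnNhd_slice bdd_of_hasTypeITimeDecay)

variable {η : EuclideanSpace ℝ (Fin 3) → ℝ} {C D : ℝ} {v : ℝ → EuclideanSpace ℝ (Fin 3) → EuclideanSpace ℝ (Fin 3)}

/-- A localised pairing with the weight `a_R` is bounded by `|B_{2R}| · A · B` when the two fields are bounded by `A`, `B`. -/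
theorem abs_locIntegral_le (hη : IsAdmissibleBump η) {R : ℝ} (hR : 0 < R) {f g : EuclideanSpace ℝ (Fin 3) → EuclideanSpace ℝ (Fin 3)}
    {A B : ℝ} (hf : ∀ x, ‖f x‖ ≤ A) (hg : ∀ x, ‖g x‖ ≤ B) :
    |∫ x, bumpSq η R x * ⟪f x, g x⟫| ≤
      (volume : Measure (EuclideanSpace ℝ (Fin 3))).real (closedBall 0 (2 * R)) * (A * B) := by
  have hA : 0 ≤ A := (norm_nonneg _).trans (hf 0)
  have hB : 0 ≤ B := (norm_nonneg _).trans (hg 0)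
  have hbd : ∀ x, ‖bumpSq η R x * ⟪f x, g x⟫‖ ≤ (closedBall (0 : EuclideanSpace ℝ (Fin 3)) (2 * R)).indicator
      (fun _ => A * B) x := by
    intro x
    by_cases hx : x ∈ closedBall (0 : EuclideanSpace ℝ (Fin 3)) (2 * R)
    · rw [indicator_of_mem hx, norm_mul, Real.norm_eq_abs, abs_of_nonneg (bumpSq_nonneg η R x)]
      calc bumpSq η R x * ‖⟪f x, g x⟫‖ ≤ 1 * (‖f x‖ * ‖g x‖) :=
            mul_le_mul (bumpSq_le_one hη R x) (norm_inner_le_norm _ _) (norm_nonneg _) zero_le_one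
        _ ≤ A * B := by rw [one_mul]; exact mul_le_mul (hf x) (hg x) (norm_nonneg _) hA
    · rw [indicator_of_notMem hx]
      have hx' : 2 * R ≤ ‖x‖ := by
        have : ¬ ‖x‖ ≤ 2 * R := by simpa [mem_closedBall, dist_zero_right] using hx
        linarith
      rw [bumpSq_eq_zero hη hR hx', zero_mul, norm_zero]
  have hint : Integrable ((closedBall (0 : EuclideanSpace ℝ (Fin 3)) (2 * R)).indicator fun _ => A * B) :=
    IntegrableOn.integrable_indicator (integrableOn_const (measure_closedBall_lt_top.ne)) measurableSet_closedBall
  rw [← Real.norm_eq_abs]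
  refine (norm_integral_le_of_norm_le hint (ae_of_all _ hbd)).trans ?_
  rw [integral_indicator measurableSet_closedBall, setIntegral_const, smul_eq_mul]

/-- **Size of the localised helicity of a door-class slice**: `|h_R(t)| ≤ |B_{2R}| · (C/√(−t)) · (‖curlCLM‖ L₁/(−t))`
with `L₁` the class's first-order scale-invariant constant. -/
theorem abs_locHelicity_slice_le (hη : IsAdmissibleBump η) (hrate : HasTypeITimeDecay C v) (hdecay : HasTypeIDecay D v)
    (hcont : ContinuousOn (Function.uncurry v) (Set.Iio (0 : ℝ) ×ˢ Set.univ))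
    (hmild : ∀ s t : ℝ, s < t → t < 0 → ∀ x,
      v t x = UnboundedOperators.heatExtension (v s) (t - s) x - oseenDuhamel 1 s v v t x)
    (hdiv : ∀ t < 0, VectorCalculus.IsDivFree (v t)) :
    ∃ L₁ : ℝ, 0 ≤ L₁ ∧ ∀ R > (0 : ℝ), ∀ t < (0 : ℝ),
      |locHelicity (bumpSq η R) (v t)| ≤
        (volume : Measure (EuclideanSpace ℝ (Fin 3))).real (closedBall 0 (2 * R)) *
          (C / Real.sqrt (-t) * (‖(curlCLM : (EuclideanSpace ℝ (Fin 3) →L[ℝ] EuclideanSpace ℝ (Fin 3)) →L[ℝ]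
            EuclideanSpace ℝ (Fin 3))‖ * L₁ / Real.sqrt (-t) ^ 2)) := by
  obtain ⟨L₁, hL₁, hslice⟩ := vorticity_slice_regularity hrate hdecay hcont hmild hdiv
  refine ⟨L₁, hL₁, fun R hR t ht => ?_⟩
  obtain ⟨hdec, -, -⟩ := hslice t ht
  have hsq : 0 < Real.sqrt (-t) := Real.sqrt_pos.2 (neg_pos.2 ht)
  have hκ : 0 ≤ ‖(curlCLM : (EuclideanSpace ℝ (Fin 3) →L[ℝ] EuclideanSpace ℝ (Fin 3)) →L[ℝ] EuclideanSpace ℝ (Fin 3))‖ :=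
    norm_nonneg ((curlCLM : (EuclideanSpace ℝ (Fin 3) →L[ℝ] EuclideanSpace ℝ (Fin 3)) →L[ℝ] EuclideanSpace ℝ (Fin 3)))
  have hω : ∀ x, ‖curl (v t) x‖ ≤ ‖(curlCLM : (EuclideanSpace ℝ (Fin 3) →L[ℝ] EuclideanSpace ℝ (Fin 3)) →L[ℝ]
      EuclideanSpace ℝ (Fin 3))‖ * L₁ / Real.sqrt (-t) ^ 2 := fun x =>
    (hdec x).trans (div_le_div_of_nonneg_left (by positivity) (by positivity)
      (pow_le_pow_left₀ hsq.le (by linarith [norm_nonneg x]) 2))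
  exact abs_locIntegral_le hη hR (fun x => hrate t ht x) hω

/-- **`h_R(t) → 0` as `t → −∞`** for a door-class profile (the bound decays like `(−t)^{−3/2}`). -/
theorem tendsto_locHelicity_atBot (hη : IsAdmissibleBump η) (hrate : HasTypeITimeDecay C v) (hdecay : HasTypeIDecay D v)
    (hcont : ContinuousOn (Function.uncurry v) (Set.Iio (0 : ℝ) ×ˢ Set.univ))
    (hmild : ∀ s t : ℝ, s < t → t < 0 → ∀ x,
      v t x = UnboundedOperators.heatExtension (v s) (t - s) x - oseenDuhamel 1 s v v t x)
    (hdiv : ∀ t < 0, VectorCalculus.IsDivFree (v t)) {R : ℝ} (hR : 0 < R) :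
    Tendsto (fun t => locHelicity (bumpSq η R) (v t)) atBot (𝓝 0) := by
  obtain ⟨L₁, hL₁, hb⟩ := abs_locHelicity_slice_le hη hrate hdecay hcont hmild hdiv
  set V : ℝ := (volume : Measure (EuclideanSpace ℝ (Fin 3))).real (closedBall 0 (2 * R)) with hV
  set κ : ℝ := ‖(curlCLM : (EuclideanSpace ℝ (Fin 3) →L[ℝ] EuclideanSpace ℝ (Fin 3)) →L[ℝ] EuclideanSpace ℝ (Fin 3))‖
    with hκ
  -- the majorant tends to `0` at `−∞` (`√(−t) → ∞`)
  have hs : Tendsto (fun t : ℝ => Real.sqrt (-t)) atBot atTop :=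
    Real.tendsto_sqrt_atTop.comp tendsto_neg_atBot_atTop
  have h1 : Tendsto (fun t : ℝ => C / Real.sqrt (-t)) atBot (𝓝 0) := tendsto_const_nhds.div_atTop hs
  have h2 : Tendsto (fun t : ℝ => κ * L₁ / Real.sqrt (-t) ^ 2) atBot (𝓝 0) :=
    tendsto_const_nhds.div_atTop ((tendsto_pow_atTop two_ne_zero).comp hs)
  have hmaj : Tendsto (fun t : ℝ => V * (C / Real.sqrt (-t) * (κ * L₁ / Real.sqrt (-t) ^ 2))) atBot (𝓝 0) := by
    simpa using (h1.mul h2).const_mul V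
  refine squeeze_zero_norm' ?_ hmaj
  filter_upwards [eventually_lt_atBot (0 : ℝ)] with t ht
  rw [Real.norm_eq_abs]
  exact hb R hR t ht

/-- **Size of the localised helicity dissipation of a door-class slice**:
`|d̃_R(t)| ≤ |B_{2R}| · (‖curlCLM‖|L₁|/√(−t)²) · (‖curlCLM‖²|L₂|/√(−t)³)`. -/
theorem abs_locHelicity_curl_slice_le (hη : IsAdmissibleBump η) (hrate : HasTypeITimeDecay C v)
    (hdecay : HasTypeIDecay D v) (hcont : ContinuousOn (Function.uncurry v) (Set.Iio (0 : ℝ) ×ˢ Set.univ))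
    (hmild : ∀ s t : ℝ, s < t → t < 0 → ∀ x,
      v t x = UnboundedOperators.heatExtension (v s) (t - s) x - oseenDuhamel 1 s v v t x)
    (hdiv : ∀ t < 0, VectorCalculus.IsDivFree (v t)) :
    ∃ M : ℝ, 0 ≤ M ∧ ∀ R > (0 : ℝ), ∀ t < (0 : ℝ),
      |locHelicity (bumpSq η R) (curl (v t))| ≤
        (volume : Measure (EuclideanSpace ℝ (Fin 3))).real (closedBall 0 (2 * R)) * (M / Real.sqrt (-t) ^ 5) := by
  obtain ⟨Q, -, hSIB⟩ := exists_classical_scaleInvariantBounds_of_class hrate hdecay hcont hmild hdiv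
  obtain ⟨L₁, hL₁⟩ := hSIB 1
  obtain ⟨L₂, hL₂⟩ := hSIB 2
  set κ : ℝ := ‖(curlCLM : (EuclideanSpace ℝ (Fin 3) →L[ℝ] EuclideanSpace ℝ (Fin 3)) →L[ℝ] EuclideanSpace ℝ (Fin 3))‖
    with hκ
  have hκ0 : 0 ≤ κ :=
    norm_nonneg ((curlCLM : (EuclideanSpace ℝ (Fin 3) →L[ℝ] EuclideanSpace ℝ (Fin 3)) →L[ℝ] EuclideanSpace ℝ (Fin 3)))
  refine ⟨κ * |L₁| * (κ * (κ * |L₂|)), by positivity, fun R hR t ht => ?_⟩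
  have hnt : 0 < -t := neg_pos.2 ht
  have hsq : 0 < Real.sqrt (-t) := Real.sqrt_pos.2 hnt
  have han : AnalyticOnNhd ℝ (v t) univ := analyticOnNhd_slice hcont (bdd_of_hasTypeITimeDecay hrate) hmild ht
  have hcd : ContDiff ℝ 2 (v t) := contDiff_iff_contDiffAt.2 fun x => (han x (mem_univ x)).contDiffAt
  have hden : ∀ (x : EuclideanSpace ℝ (Fin 3)) (n : ℕ), Real.sqrt (-t) ^ n ≤ (‖x‖ + Real.sqrt (-t)) ^ n :=
    fun x n => pow_le_pow_left₀ hsq.le (by linarith [norm_nonneg x]) n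
  have hD1 : ∀ x, ‖fderiv ℝ (v t) x‖ ≤ |L₁| / Real.sqrt (-t) ^ 2 := fun x => by
    have h := (hL₁ t ht x).1
    rw [norm_iteratedFDeriv_one] at h
    exact h.trans ((div_le_div_of_nonneg_right (le_abs_self _) (by positivity)).trans
      (div_le_div_of_nonneg_left (abs_nonneg _) (by positivity) (hden x 2)))
  have hD2 : ∀ x, ‖iteratedFDeriv ℝ 2 (v t) x‖ ≤ |L₂| / Real.sqrt (-t) ^ 3 := fun x =>
    (hL₂ t ht x).1.trans ((div_le_div_of_nonneg_right (le_abs_self _) (by positivity)).trans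
      (div_le_div_of_nonneg_left (abs_nonneg _) (by positivity) (hden x 3)))
  have hω : ∀ x, ‖curl (v t) x‖ ≤ κ * |L₁| / Real.sqrt (-t) ^ 2 := fun x => by
    rw [mul_div_assoc]; exact (norm_curl_le _ _).trans (mul_le_mul_of_nonneg_left (hD1 x) hκ0)
  have hωω : ∀ x, ‖curl (curl (v t)) x‖ ≤ κ * (κ * |L₂|) / Real.sqrt (-t) ^ 3 := fun x => by
    rw [mul_div_assoc, mul_div_assoc]
    refine (norm_curl_le _ _).trans (mul_le_mul_of_nonneg_left ?_ hκ0)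
    exact (norm_fderiv_curl_le hcd x).trans (mul_le_mul_of_nonneg_left (hD2 x) hκ0)
  refine (abs_locIntegral_le hη hR hω hωω).trans (le_of_eq ?_)
  rw [div_mul_div_comm, ← pow_add]

/-- **`t ↦ d̃_R(t) = locHelicity a_R (curl v(t))` is integrable on `(−∞, t₀)` for `t₀ < 0`** (measurable by the joint
smoothness of the profile, `…LocalDissipationLower.aestronglyMeasurable_locHelicity_curl`; dominated by
`|B_{2R}| M (−t)^{−5/2}`). -/
theorem integrableOn_locHelicity_curl (hη : IsAdmissibleBump η) (hrate : HasTypeITimeDecay C v)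
    (hdecay : HasTypeIDecay D v) (hcont : ContinuousOn (Function.uncurry v) (Set.Iio (0 : ℝ) ×ˢ Set.univ))
    (hmild : ∀ s t : ℝ, s < t → t < 0 → ∀ x,
      v t x = UnboundedOperators.heatExtension (v s) (t - s) x - oseenDuhamel 1 s v v t x)
    (hdiv : ∀ t < 0, VectorCalculus.IsDivFree (v t)) {R : ℝ} (hR : 0 < R) {t₀ : ℝ} (ht₀ : t₀ < 0) :
    IntegrableOn (fun t => locHelicity (bumpSq η R) (curl (v t))) (Iio t₀) := by
  obtain ⟨M, hM, hb⟩ := abs_locHelicity_curl_slice_le hη hrate hdecay hcont hmild hdiv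
  set V : ℝ := (volume : Measure (EuclideanSpace ℝ (Fin 3))).real (closedBall 0 (2 * R)) with hV
  have hsmooth : ContDiffOn ℝ 2 (uncurry v) (Iio (0 : ℝ) ×ˢ univ) :=
    (isTypeIAncientMild_of_class hrate hcont hmild hdiv).1.of_le (by norm_cast)
  have hmeas := aestronglyMeasurable_locHelicity_curl hsmooth hη R ht₀.le
  -- the majorant `t ↦ V M (−t)^{−5/2}` is integrable on `(−∞, t₀)`
  have hmaj : IntegrableOn (fun t : ℝ => V * M * (-t) ^ (-(5 / 2 : ℝ))) (Iio t₀) := by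
    have h := integrableOn_Ioi_rpow_of_lt (by norm_num : (-(5 / 2 : ℝ)) < -1) (neg_pos.2 ht₀)
    have h' := integrableOn_Iio_comp_neg (c := t₀) (f := fun s : ℝ => s ^ (-(5 / 2 : ℝ))) h
    exact h'.const_mul (V * M)
  refine hmaj.mono' hmeas ((ae_restrict_iff' measurableSet_Iio).2 (ae_of_all _ fun t ht => ?_))
  have ht0 : t < 0 := ht.trans ht₀
  have hnt : 0 < -t := neg_pos.2 ht0
  rw [Real.norm_eq_abs]
  refine (hb R hR t ht0).trans (le_of_eq ?_)
  have h5 : Real.sqrt (-t) ^ 5 = (-t) ^ (5 / 2 : ℝ) := by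
    rw [Real.sqrt_eq_rpow, ← Real.rpow_natCast, ← Real.rpow_mul hnt.le]
    norm_num
  rw [h5, Real.rpow_neg hnt.le, div_eq_mul_inv]
  ring

end Summit.NavierStokesRegularity.NavierStokesRegularity.Theorems.ChiralWindowDoorHelicityBudgetTools
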